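import Summits.Parity.GeneralizedHardyLittlewood.Theorems.PrimeLevelFamEdgeMomentsBeyondDiagonalDiagDecorKappaCrudeCollapse
import Summits.Parity.GeneralizedHardyLittlewood.Theorems.PrimeLevelFamEdgeMomentsBeyondDiagonalDiagDecorBilinear
import Summits.Parity.GeneralizedHardyLittlewood.Theorems.PrimeLevelFamEdgeMomentsBeyondDiagonalDiagDecorShiftedBlockDecorTwoSel
import HarnessLib

/-!
# Route `PrimeLevelFamEdge`, crux K_A `MomentsBeyondDiagonal` (stmt-Parity-20007), line «petersson_layers» v4, stub `stub_diag`: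
# **the two-sided `M₄ ⊗ M₄` shifted BLOCK is `O(log^{p+r₁+r₂+4}M)`:
# `|Sel(τ(3P₂²−2P₄)(k₁)ℓ⁺(k₁)^{r₁}·τ(3P₂²−2P₄)(k₂)ℓ⁺(k₂)^{r₂}·B^p)| ≤ C·log^{p+r₁+r₂+4}M`**

The block layer of the two-sided `M₄ ⊗ M₄` crude engine needed by order `(4,4)` of `stub_diag` (rung 4; the monomials
`M₄(k₁)·M₄(k₂)·L^m`, `m ≤ 1`, of `…DiagDecorOrderRungFourHecke.heckeSum_orderFourFour_eq` carry no main term at the top order;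
trivial size `log^{m+5}M`, error budget `log⁵M`, so ONE `M₄`-cancellation suffices): the `M₄`-coordinate on `k₁` keeps its
`(1+κ)`-weighted crude size `K₁D(n)(1+κ(n))log^{r₁+1}M` (`…DiagDecorM4Coord.abs_shiftedCoordM4_le`), the one on `k₂` is weakened to
`K₂D(n)log^{r₂+2}M` (`κ(n) ≤ log n ≤ log M`, `…DiagDecorBilinear.kappa_le_log`); then the exact two-sided expansion
`…ShiftedBlockDecorTwoSel.selbergBlockDecorTwo_expand` (`D₁ = D₂ = 3P₂² − 2P₄`) and the generic crude collapse
`…DiagDecorKappaCrudeCollapse.abs_collapseKappaCrude_le` (each `(log g)^t` piece `O(log^{t+(p−t)+(r₁+1)+(r₂+2)+1}M)`):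

* `abs_shiftedCoordM4_crude_le` — the weakened crude size of the `M₄`-coordinate;
* `abs_selbergBlockM4M4_le` — **the displayed crude block bound** (`0 ≤ λ ≤ 1`, `P₀ = P₁ = 0`, `M ≥ 3`).

Remaining for the `M₄ ⊗ M₄` family bound `|Sel(τD(k₁)·τD(k₂)·L^m)| ≤ C log^{m+4}M`: `L = 2B + ℓ⁺₁ + ℓ⁺₂` (next file).
Def-free; theorems only. Helper `--supports stmt-Parity-20007`; closes nothing; K_A, K_B and the Parity summit are NOT proved;
nothing about Landau–Siegel zeros.

## References
* E. Kowalski, P. Michel, J. VanderKam, J. reine angew. Math. 526 (2000), (23)–(28) pp. 13–15 and Prop. 5.1 p. 18.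
  [cite: KowalskiMichelVanderKam2000, (23)–(28) — derivation (diagonal weight in real Selberg coordinates, fourth divisor-log moments)]
-/

noncomputable section

open scoped Real ArithmeticFunction.Moebius
open Finset ArithmeticFunction Polynomial

namespace Summit.Parity.GeneralizedHardyLittlewood.Theorems.MomentsBeyondDiagonal.DiagKernel

open Literature.NumberTheory.LFunctions Literature.NumberTheory.LFunctions.KMV2000
open MollifierMainTerm (W)
open SelbergCoord (kappa)
open Literature.NumberTheory.Sieve (one_le_log_of_three_le)
open Summit.Parity.GeneralizedHardyLittlewood.Theorems.BeyondDiagonalBeatsQuarter.KernelFormXSq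
  (divWeight divWeight_nonneg)

/-- **Weakened crude size of the `M₄`-decorated shifted coordinate** (the `(1+κ)` weight absorbed into one more log:
`κ(n) ≤ log n ≤ log M`): `|T_{M₄}^{[r]}(M;n)| ≤ K·D(n)·log^{r+2}M` (`P₀ = P₁ = 0`, `M ≥ 3`, `1 ≤ n ≤ M`).
[cite: KowalskiMichelVanderKam2000, (23)–(28) — derivation] -/
theorem abs_shiftedCoordM4_crude_le (P : ℝ[X]) (hP0 : P.coeff 0 = 0) (hP1 : P.coeff 1 = 0) (r : ℕ) :
    ∃ K : ℝ, 0 ≤ K ∧ ∀ M : ℝ, 3 ≤ M → ∀ n : ℕ, n ≠ 0 → (n : ℝ) ≤ M →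
      |∑ c ∈ Finset.range (P.natDegree + 1), P.coeff c *
          ((∑ k ∈ Icc 1 ⌊M / n⌋₊, (if k.Coprime n then W k else 0) *
              ((k.divisors.card : ℝ) *
                (3 * (∑ p ∈ k.primeFactors, Real.log p ^ 2) ^ 2 - 2 * ∑ p ∈ k.primeFactors, Real.log p ^ 4)) *
            Real.log (M / n / k) ^ (c + r)) / Real.log M ^ c)| ≤
        K * divWeight n * Real.log M ^ (r + 2) := by
  obtain ⟨K, hK, h⟩ := abs_shiftedCoordM4_le P hP0 hP1 r
  refine ⟨2 * K, by positivity, fun M hM n hn hnM ↦ ?_⟩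
  have hℓ1 : 1 ≤ Real.log M := one_le_log_of_three_le hM
  have hD := divWeight_nonneg n
  have hκ : 0 ≤ kappa n := by
    unfold kappa
    exact Finset.sum_nonneg fun p hp ↦ by
      have hp2 : (2 : ℝ) ≤ p := by exact_mod_cast (Nat.prime_of_mem_primeFactors hp).two_le
      exact div_nonneg (Real.log_nonneg (by linarith)) (by linarith)
  have hκℓ : kappa n ≤ Real.log M := (kappa_le_log hn).trans
    (Real.log_le_log (by exact_mod_cast Nat.pos_of_ne_zero hn) hnM)
  refine (h M hM n hn hnM).trans ?_
  have h1 : 1 + kappa n ≤ 2 * Real.log M := by linarith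
  calc K * divWeight n * (1 + kappa n) * Real.log M ^ (r + 1)
      ≤ K * divWeight n * (2 * Real.log M) * Real.log M ^ (r + 1) := by gcongr
    _ = 2 * K * divWeight n * Real.log M ^ (r + 2) := by rw [pow_succ]; ring

/-- **The two-sided `M₄ ⊗ M₄` shifted block is `O(log^{p+r₁+r₂+4}M)`** (see the module docstring).
[cite: KowalskiMichelVanderKam2000, (23)–(28) — derivation] -/
theorem abs_selbergBlockM4M4_le (P : ℝ[X]) (hP0 : P.coeff 0 = 0) (hP1 : P.coeff 1 = 0) (p r₁ r₂ : ℕ)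
    {lam : ℝ} (hlam0 : 0 ≤ lam) (hlam1 : lam ≤ 1) :
    ∃ C : ℝ, 0 < C ∧ ∀ M : ℝ, 3 ≤ M →
      |∑ c ∈ Icc 1 ⌊M⌋₊, ∑ g ∈ Icc 1 (⌊M⌋₊ / c), (μ g : ℝ) * c *
          ∑ k₁ ∈ Icc 1 (⌊M⌋₊ / (c * g)), ∑ k₂ ∈ Icc 1 (⌊M⌋₊ / (c * g)),
            ((μ (c * g * k₁) : ℝ) * ((psi (c * g * k₁))⁻¹ *
                P.eval (Real.log (M / ((c * g * k₁ : ℕ) : ℝ)) / Real.log M))) / ((c * g * k₁ : ℕ) : ℝ) *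
              (((μ (c * g * k₂) : ℝ) * ((psi (c * g * k₂))⁻¹ *
                P.eval (Real.log (M / ((c * g * k₂ : ℕ) : ℝ)) / Real.log M))) / ((c * g * k₂ : ℕ) : ℝ)) *
              (((k₁.divisors.card : ℝ) *
                  (3 * (∑ q ∈ k₁.primeFactors, Real.log q ^ 2) ^ 2 - 2 * ∑ q ∈ k₁.primeFactors, Real.log q ^ 4) *
                  Real.log (M / ((c * g : ℕ) : ℝ) / k₁) ^ r₁) *
                ((k₂.divisors.card : ℝ) *
                  (3 * (∑ q ∈ k₂.primeFactors, Real.log q ^ 2) ^ 2 - 2 * ∑ q ∈ k₂.primeFactors, Real.log q ^ 4) *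
                  Real.log (M / ((c * g : ℕ) : ℝ) / k₂) ^ r₂) *
                (lam * Real.log M - Real.log g - Real.log (M / ((c * g : ℕ) : ℝ))) ^ p)| ≤
        C * Real.log M ^ (p + r₁ + r₂ + 4) := by
  -- crude coordinate sizes
  obtain ⟨K₁, hK₁, hb₁⟩ := abs_shiftedCoordM4_le P hP0 hP1 r₁
  obtain ⟨K₂, hK₂, hb₂⟩ := abs_shiftedCoordM4_crude_le P hP0 hP1 r₂
  -- one constant per `t`
  have hex : ∀ t : ℕ, ∃ C : ℝ, 0 < C ∧ (t ≤ p → ∀ M : ℝ, 3 ≤ M →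
      |∑ c ∈ Icc 1 ⌊M⌋₊, ∑ g ∈ Icc 1 (⌊M⌋₊ / c), (μ g : ℝ) * c * Real.log g ^ t * (W (c * g) ^ 2 *
          ((lam * Real.log M - Real.log (M / ((c * g : ℕ) : ℝ))) ^ (p - t) *
            (∑ c' ∈ Finset.range (P.natDegree + 1), P.coeff c' *
              ((∑ k ∈ Icc 1 ⌊M / ((c * g : ℕ) : ℝ)⌋₊, (if k.Coprime (c * g) then W k else 0) *
                ((k.divisors.card : ℝ) *
                  (3 * (∑ q ∈ k.primeFactors, Real.log q ^ 2) ^ 2 - 2 * ∑ q ∈ k.primeFactors, Real.log q ^ 4)) *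
                Real.log (M / ((c * g : ℕ) : ℝ) / k) ^ (c' + r₁)) / Real.log M ^ c')) *
            (∑ c' ∈ Finset.range (P.natDegree + 1), P.coeff c' *
              ((∑ k ∈ Icc 1 ⌊M / ((c * g : ℕ) : ℝ)⌋₊, (if k.Coprime (c * g) then W k else 0) *
                ((k.divisors.card : ℝ) *
                  (3 * (∑ q ∈ k.primeFactors, Real.log q ^ 2) ^ 2 - 2 * ∑ q ∈ k.primeFactors, Real.log q ^ 4)) *
                Real.log (M / ((c * g : ℕ) : ℝ) / k) ^ (c' + r₂)) / Real.log M ^ c'))))| ≤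
        C * Real.log M ^ (p + r₁ + r₂ + 4)) := by
    intro t
    by_cases htp : t ≤ p
    · obtain ⟨C, hC, h⟩ := abs_collapseKappaCrude_le
        (fun M n ↦ ∑ c' ∈ Finset.range (P.natDegree + 1), P.coeff c' *
          ((∑ k ∈ Icc 1 ⌊M / n⌋₊, (if k.Coprime n then W k else 0) *
            ((k.divisors.card : ℝ) *
              (3 * (∑ q ∈ k.primeFactors, Real.log q ^ 2) ^ 2 - 2 * ∑ q ∈ k.primeFactors, Real.log q ^ 4)) *
            Real.log (M / n / k) ^ (c' + r₁)) / Real.log M ^ c'))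
        (fun M n ↦ ∑ c' ∈ Finset.range (P.natDegree + 1), P.coeff c' *
          ((∑ k ∈ Icc 1 ⌊M / n⌋₊, (if k.Coprime n then W k else 0) *
            ((k.divisors.card : ℝ) *
              (3 * (∑ q ∈ k.primeFactors, Real.log q ^ 2) ^ 2 - 2 * ∑ q ∈ k.primeFactors, Real.log q ^ 4)) *
            Real.log (M / n / k) ^ (c' + r₂)) / Real.log M ^ c'))
        (r₁ + 1) (r₂ + 2) hK₁ hK₂ hb₁ hb₂ t (p - t) hlam0 hlam1
      refine ⟨C, hC, fun _ M hM ↦ ?_⟩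
      have h' := h M hM
      rw [show t + (p - t) + (r₁ + 1) + (r₂ + 2) + 1 = p + r₁ + r₂ + 4 by omega] at h'
      exact h'
    · exact ⟨1, one_pos, fun h ↦ absurd h htp⟩
  choose Ct hCt0 hCt using hex
  set K : ℝ := ∑ t ∈ Finset.range (p + 1), (p.choose t : ℝ) * Ct t with hK
  have hK0 : 0 ≤ K := Finset.sum_nonneg fun t _ ↦ by have := hCt0 t; positivity
  refine ⟨K + 1, by positivity, fun M hM ↦ ?_⟩
  have hℓ1 : 1 ≤ Real.log M := one_le_log_of_three_le hM
  have hx := selbergBlockDecorTwo_expand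
    (fun k : ℕ ↦ 3 * (∑ q ∈ k.primeFactors, Real.log q ^ 2) ^ 2 - 2 * ∑ q ∈ k.primeFactors, Real.log q ^ 4)
    (fun k : ℕ ↦ 3 * (∑ q ∈ k.primeFactors, Real.log q ^ 2) ^ 2 - 2 * ∑ q ∈ k.primeFactors, Real.log q ^ 4) P M lam p r₁ r₂
  beta_reduce at hx
  rw [hx]
  have hterm : ∀ t ∈ Finset.range (p + 1), |(p.choose t : ℝ) * (-1) ^ t *
      ∑ c ∈ Icc 1 ⌊M⌋₊, ∑ g ∈ Icc 1 (⌊M⌋₊ / c), (μ g : ℝ) * c * Real.log g ^ t * (W (c * g) ^ 2 *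
          ((lam * Real.log M - Real.log (M / ((c * g : ℕ) : ℝ))) ^ (p - t) *
            (∑ c' ∈ Finset.range (P.natDegree + 1), P.coeff c' *
              ((∑ k ∈ Icc 1 ⌊M / ((c * g : ℕ) : ℝ)⌋₊, (if k.Coprime (c * g) then W k else 0) *
                ((k.divisors.card : ℝ) *
                  (3 * (∑ q ∈ k.primeFactors, Real.log q ^ 2) ^ 2 - 2 * ∑ q ∈ k.primeFactors, Real.log q ^ 4)) *
                Real.log (M / ((c * g : ℕ) : ℝ) / k) ^ (c' + r₁)) / Real.log M ^ c')) *
            (∑ c' ∈ Finset.range (P.natDegree + 1), P.coeff c' *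
              ((∑ k ∈ Icc 1 ⌊M / ((c * g : ℕ) : ℝ)⌋₊, (if k.Coprime (c * g) then W k else 0) *
                ((k.divisors.card : ℝ) *
                  (3 * (∑ q ∈ k.primeFactors, Real.log q ^ 2) ^ 2 - 2 * ∑ q ∈ k.primeFactors, Real.log q ^ 4)) *
                Real.log (M / ((c * g : ℕ) : ℝ) / k) ^ (c' + r₂)) / Real.log M ^ c'))))| ≤
        (p.choose t : ℝ) * Ct t * Real.log M ^ (p + r₁ + r₂ + 4) := by
    intro t ht
    have htp : t ≤ p := Nat.lt_succ_iff.1 (Finset.mem_range.1 ht)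
    have h := hCt t htp M hM
    rw [abs_mul, abs_mul, abs_pow, abs_neg, abs_one, one_pow, mul_one,
      abs_of_nonneg (by positivity : (0 : ℝ) ≤ (p.choose t : ℝ)), mul_assoc]
    exact mul_le_mul_of_nonneg_left h (by positivity)
  calc _ ≤ ∑ t ∈ Finset.range (p + 1), (p.choose t : ℝ) * Ct t * Real.log M ^ (p + r₁ + r₂ + 4) :=
        (Finset.abs_sum_le_sum_abs _ _).trans (Finset.sum_le_sum hterm)
    _ = K * Real.log M ^ (p + r₁ + r₂ + 4) := by rw [hK, Finset.sum_mul]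
    _ ≤ (K + 1) * Real.log M ^ (p + r₁ + r₂ + 4) := by gcongr; linarith

end Summit.Parity.GeneralizedHardyLittlewood.Theorems.MomentsBeyondDiagonal.DiagKernel

end
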